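import Literature.Computability.Complexity.StackPrograms
import Literature.Computability.Complexity.Transducers
import Mathlib.Algebra.Order.BigOperators.Group.Finset
import Mathlib.Tactic.DeriveFintype
import HarnessLib

/-!
# Counter programs generating strings: nested counted loops are polynomial time

Trunk `CplxCore`, toolkit for uniformity proofs (`TimeBounds.lean`, `StackPrograms.lean`).
Descriptions of circuit families (`P`-uniform families, Arora–Barak 2009, §6.2 Def. 6.12: a
polynomial-time TM that on input `1ⁿ` outputs the description of `Cₙ`; for the tableau circuit
Remark 6.7) are produced — this is our reading of such constructions, not a quotation — by
programs of a very restricted shape: nested loops `for i < e do …` whose bounds `e` and whose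
emitted numerals are polynomial expressions in the input length and the enclosing loop indices.
This file proves, once and for all, that every such **generator program** runs in polynomial
time on Mathlib's `TM2` model, so that a uniformity proof reduces to a *pure* identity between
the generated stream and the description.

* `GExpr V` — expressions `c | x | e + e | e * e` over counter variables `x : V`
  (`GExpr.eval`).
* `GStmt V Γ` — generator programs over an output alphabet `Γ`:
  `emit ts | s ; s | loop i e s` (`loop`: for `i = 0, …, e - 1` run `s`); the generated
  stream is `GStmt.out` (`loop i e s ↦ (range e).flatMap fun k => out s (env[i ↦ k])`).
  Loop indices are `0` outside their loops and a loop index is not reused by a nested loop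
  (`GStmt.loopVars`, `GStmt.noReuse`).
* Compilation to structured stack programs (`StackPrograms.lean`): registers `GReg V D`
  (a unary register per variable, `D` loop counters, scratch, output); `GenProg.evalC`,
  `GenProg.stmtC`, `GenProg.progC`; exact cost functions `GExpr.cost`, `GStmt.cost` and their
  polynomial majorants `GExpr.cpoly`, `GStmt.cpoly` in a bound of the variables
  (`GStmt.cost_le`).
* `GenProg.stmtC_runs` — adequacy: the compiled program runs within `GStmt.cost` and pushes
  the (coded) stream; `GStmt.out_mem_FP` — **the coded stream `z ↦ code (out s (x₀ ↦ |z|))`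
  is in `FP`**; with a three-bit block code decoded by a finite-state transducer
  (`GenProg.decFST`, `Transducers.lean`) and machine composition
  (`PolyTimeComputable.comp_holds`), `GStmt.polyTimeComputable_out` — **the stream
  `n ↦ out s (x₀ ↦ n)` is `PolyTimeComputable` from `1ⁿ`** for any output alphabet with at
  most eight letters coded by `enc`/`dec`.

This is counter-machine folklore (Minsky 1967, §11.1) applied to the polynomial-time
computability of circuit descriptions (Arora–Barak 2009, Def. 6.12, Remark 6.7), made into a
reusable combinator: no machine is ever written again for a uniformity proof.

## References

* S. Arora, B. Barak, *Computational Complexity: A Modern Approach*, CUP 2009, §1.3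
  (robustness of polynomial time), §6.2, Def. 6.12 and Thm. 6.13 (`P`-uniform circuit
  families), Remark 6.7.
* M. L. Minsky, *Computation: Finite and Infinite Machines*, Prentice-Hall 1967, §11.1
  (program machines with counters).
* T. Nipkow, G. Klein, *Concrete Semantics with Isabelle/HOL*, Springer 2014, Ch. 7–8.
-/

namespace Literature.Computability.Complexity

open _root_.Computability Polynomial

/-! ### Counter expressions -/

/-- Counter expressions over variables `V`: constants, variables, sums, products.
[Minsky 1967, §11.1] [folklore] -/
inductive GExpr (V : Type) where
  /-- a constant -/
  | const (c : ℕ)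
  /-- the value of a counter variable -/
  | var (x : V)
  /-- sum -/
  | add (a b : GExpr V)
  /-- product -/
  | mul (a b : GExpr V)

namespace GExpr

variable {V : Type}

/-- The value of an expression in an environment. [folklore] -/
def eval (env : V → ℕ) : GExpr V → ℕ
  | const c => c
  | var x => env x
  | add a b => a.eval env + b.eval env
  | mul a b => a.eval env * b.eval env

/-- The number of loop counters needed to evaluate an expression (nesting depth of
products). [folklore] -/
def depth : GExpr V → ℕ
  | const _ => 0
  | var _ => 0
  | add a b => max a.depth b.depth
  | mul a b => max a.depth b.depth + 1

/-- The exact cost of the compiled evaluation (`GenProg.evalC_runs`). [folklore] -/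
def cost (env : V → ℕ) : GExpr V → ℕ
  | const c => c
  | var x => 7 * env x + 2
  | add a b => a.cost env + b.cost env
  | mul a b => a.cost env + a.eval env * (b.cost env + 2) + 1

/-- A polynomial majorant of the value in terms of a bound on the variables. [folklore] -/
noncomputable def vpoly : GExpr V → Polynomial ℕ
  | const c => C c
  | var _ => X
  | add a b => a.vpoly + b.vpoly
  | mul a b => a.vpoly * b.vpoly

/-- A polynomial majorant of the cost in terms of a bound on the variables. [folklore] -/
noncomputable def cpoly : GExpr V → Polynomial ℕ
  | const c => C c
  | var _ => 7 * X + 2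
  | add a b => a.cpoly + b.cpoly
  | mul a b => a.cpoly + a.vpoly * (b.cpoly + 2) + 1

/-- Values are bounded by `vpoly` of a bound on the variables. [folklore] -/
theorem eval_le {env : V → ℕ} {U : ℕ} (hU : ∀ x, env x ≤ U) :
    ∀ e : GExpr V, e.eval env ≤ e.vpoly.eval U
  | const c => by simp [eval, vpoly]
  | var x => by simpa [eval, vpoly] using hU x
  | add a b => by
    simp only [eval, vpoly, eval_add]
    exact Nat.add_le_add (eval_le hU a) (eval_le hU b)
  | mul a b => by
    simp only [eval, vpoly, eval_mul]
    exact Nat.mul_le_mul (eval_le hU a) (eval_le hU b)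

/-- Costs are bounded by `cpoly` of a bound on the variables. [folklore] -/
theorem cost_le {env : V → ℕ} {U : ℕ} (hU : ∀ x, env x ≤ U) :
    ∀ e : GExpr V, e.cost env ≤ e.cpoly.eval U
  | const c => by simp [cost, cpoly]
  | var x => by
    have := hU x
    simp only [cost, cpoly, eval_add, eval_mul, eval_ofNat, eval_X]
    omega
  | add a b => by
    simp only [cost, cpoly, eval_add]
    exact Nat.add_le_add (cost_le hU a) (cost_le hU b)
  | mul a b => by
    simp only [cost, cpoly, eval_add, eval_mul, eval_ofNat, eval_one]
    have h1 := cost_le hU a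
    have h2 := cost_le hU b
    have h3 := eval_le hU a
    exact Nat.add_le_add_right (Nat.add_le_add h1 (Nat.mul_le_mul h3 (Nat.add_le_add_right h2 _))) _

end GExpr

/-! ### Generator programs -/

/-- Generator programs over counter variables `V` emitting letters of `Γ`: emission of a
literal word, sequence, and the counted loop `loop i e s` ("for `i = 0, …, e - 1` do `s`",
the bound being evaluated at loop entry). [Minsky 1967, §11.1; Arora–Barak 2009, §6.2
Def. 6.12] [folklore] -/
inductive GStmt (V Γ : Type) where
  /-- emit a literal word -/
  | emit (ts : List Γ)
  /-- sequence -/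
  | seq (a b : GStmt V Γ)
  /-- counted loop with index `i` and bound `e` -/
  | loop (i : V) (e : GExpr V) (body : GStmt V Γ)

namespace GStmt

variable {V Γ : Type} [DecidableEq V]

/-- **The generated stream.** [folklore] -/
def out : GStmt V Γ → (V → ℕ) → List Γ
  | emit ts, _ => ts
  | seq a b, env => a.out env ++ b.out env
  | loop i e body, env => (List.range (e.eval env)).flatMap fun k => body.out (Function.update env i k)

omit [DecidableEq V] in
/-- The loop indices occurring in a program. [folklore] -/
def loopVars : GStmt V Γ → List V
  | emit _ => []
  | seq a b => a.loopVars ++ b.loopVars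
  | loop i _ body => i :: body.loopVars

/-- No loop index is reused by a nested loop (a `Bool`, to be checked by `decide`).
[folklore] -/
def noReuse : GStmt V Γ → Bool
  | emit _ => true
  | seq a b => a.noReuse && b.noReuse
  | loop i _ body => decide (i ∉ body.loopVars) && body.noReuse

omit [DecidableEq V] in
/-- The number of loop counters needed. [folklore] -/
def depth : GStmt V Γ → ℕ
  | emit _ => 0
  | seq a b => max a.depth b.depth
  | loop _ e body => max e.depth body.depth + 1

variable (code : Γ → List Bool)

/-- The exact cost of the compiled program (`GenProg.stmtC_runs`), for the letter code
`code`. [folklore] -/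
def cost : GStmt V Γ → (V → ℕ) → ℕ
  | emit ts, _ => (ts.flatMap code).length
  | seq a b, env => a.cost env + b.cost env
  | loop i e body, env =>
    e.cost env + ((∑ m ∈ Finset.range (e.eval env), (body.cost (Function.update env i m) + 1)) +
      2 * e.eval env + 1) + (2 * e.eval env + 1)

omit [DecidableEq V] in
/-- A polynomial majorant of the cost in terms of a bound on the variables. [folklore] -/
noncomputable def cpoly : GStmt V Γ → Polynomial ℕ
  | emit ts => C (ts.flatMap code).length
  | seq a b => a.cpoly + b.cpoly
  | loop _ e body =>
    e.cpoly + (e.vpoly * ((body.cpoly).comp (X + e.vpoly) + 1) + 2 * e.vpoly + 1) + (2 * e.vpoly + 1)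

/-- **Costs are polynomially bounded** in a bound `U` on the variables (inside a loop the
variables are bounded by `U + e(U)`). [folklore] -/
theorem cost_le : ∀ (s : GStmt V Γ) {env : V → ℕ} {U : ℕ} (_ : ∀ x, env x ≤ U),
    s.cost code env ≤ (s.cpoly code).eval U
  | emit ts, env, U, hU => by simp only [cost, cpoly, eval_C]; exact le_rfl
  | seq a b, env, U, hU => by
    simp only [cost, cpoly, eval_add]
    exact Nat.add_le_add (cost_le a hU) (cost_le b hU)
  | loop i e body, env, U, hU => by
    simp only [cost, cpoly, eval_add, eval_mul, eval_one, eval_ofNat]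
    have hN := e.eval_le hU
    have hc := e.cost_le hU
    set N := e.eval env
    have hbody : ∀ m ∈ Finset.range N, body.cost code (Function.update env i m) + 1 ≤
        ((body.cpoly code).comp (X + e.vpoly)).eval U + 1 := by
      intro m hm
      rw [Finset.mem_range] at hm
      refine Nat.add_le_add_right ?_ _
      rw [eval_comp, eval_add, eval_X]
      refine cost_le body fun x => ?_
      rcases eq_or_ne x i with rfl | hx
      · rw [Function.update_self]; omega
      · rw [Function.update_of_ne hx]; exact (hU x).trans (Nat.le_add_right _ _)
    have hsum := Finset.sum_le_card_nsmul _ _ _ hbody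
    rw [Finset.card_range, smul_eq_mul] at hsum
    have : N * (((body.cpoly code).comp (X + e.vpoly)).eval U + 1) ≤
        e.vpoly.eval U * (((body.cpoly code).comp (X + e.vpoly)).eval U + 1) :=
      Nat.mul_le_mul_right _ hN
    omega

/-- The coded stream is no longer than the cost of producing it. [folklore] -/
theorem length_out_le : ∀ (s : GStmt V Γ) (env : V → ℕ),
    ((s.out env).flatMap code).length ≤ s.cost code env
  | emit ts, env => le_rfl
  | seq a b, env => by
    simp only [out, cost, List.flatMap_append, List.length_append]
    exact Nat.add_le_add (length_out_le a env) (length_out_le b env)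
  | loop i e body, env => by
    simp only [out, cost]
    generalize e.eval env = N
    have : ∀ n, (((List.range n).flatMap fun k => body.out (Function.update env i k)).flatMap
        code).length ≤ ∑ m ∈ Finset.range n, (body.cost code (Function.update env i m) + 1) := by
      intro n
      induction n with
      | zero => simp
      | succ n ih =>
        rw [List.range_succ, List.flatMap_append, List.flatMap_append, List.length_append,
          Finset.sum_range_succ]
        have := length_out_le body (Function.update env i n)
        simp only [List.flatMap_singleton] at *
        omega
    have := this N
    omega

end GStmt

/-! ### Compilation to structured stack programs -/

/-- The registers of a compiled generator: a unary register per variable, `D` loop counters,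
a scratch register, the (reversed) output, the result, the raw input. [folklore] -/
inductive GReg (V : Type) (D : ℕ) where
  /-- the unary register of a variable -/
  | main (x : V)
  /-- loop counter number `j` -/
  | cnt (j : Fin D)
  /-- scratch register for non-destructive reads -/
  | tmp
  /-- the emitted bits, most recent first -/
  | out
  /-- the result (the emitted bits in order) -/
  | res
  /-- the raw input -/
  | inp
  deriving DecidableEq, Fintype

namespace GenProg

variable {V Γ : Type} [DecidableEq V] {D : ℕ}

/-- Loop counter number `δ` (the scratch register if out of range, which correct programs
never use). [folklore] -/
def cntR (δ : ℕ) : GReg V D := if h : δ < D then GReg.cnt ⟨δ, h⟩ else GReg.tmp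

omit [DecidableEq V] in
/-- In range, `cntR δ` is the counter `δ`. [folklore] -/
theorem cntR_eq {δ : ℕ} (h : δ < D) : (cntR δ : GReg V D) = GReg.cnt ⟨δ, h⟩ := dif_pos h

/-- Register files by components: variables, counters (indexed by `ℕ`), scratch, output,
result, input. [folklore] -/
def mk (ms : V → List Bool) (cs : ℕ → List Bool) (t o r i : List Bool) : Regs (GReg V D)
  | GReg.main x => ms x
  | GReg.cnt j => cs j
  | GReg.tmp => t
  | GReg.out => o
  | GReg.res => r
  | GReg.inp => i

omit [DecidableEq V] in
/-- Projection of `mk` on a main register. [folklore] -/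
@[simp] theorem mk_main (ms : V → List Bool) (cs t o r i) (x : V) :
    (mk ms cs t o r i : Regs (GReg V D)) (GReg.main x) = ms x := rfl
omit [DecidableEq V] in
/-- Projection of `mk` on a counter register. [folklore] -/
@[simp] theorem mk_cnt (ms : V → List Bool) (cs t o r i) (j : Fin D) :
    (mk ms cs t o r i : Regs (GReg V D)) (GReg.cnt j) = cs j := rfl
omit [DecidableEq V] in
/-- Projection of `mk` on the scratch register. [folklore] -/
@[simp] theorem mk_tmp (ms : V → List Bool) (cs t o r i) :
    (mk ms cs t o r i : Regs (GReg V D)) GReg.tmp = t := rfl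
omit [DecidableEq V] in
/-- Projection of `mk` on the output register. [folklore] -/
@[simp] theorem mk_out (ms : V → List Bool) (cs t o r i) :
    (mk ms cs t o r i : Regs (GReg V D)) GReg.out = o := rfl
omit [DecidableEq V] in
/-- Projection of `mk` on the result register. [folklore] -/
@[simp] theorem mk_res (ms : V → List Bool) (cs t o r i) :
    (mk ms cs t o r i : Regs (GReg V D)) GReg.res = r := rfl
omit [DecidableEq V] in
/-- Projection of `mk` on the input register. [folklore] -/
@[simp] theorem mk_inp (ms : V → List Bool) (cs t o r i) :
    (mk ms cs t o r i : Regs (GReg V D)) GReg.inp = i := rfl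

/-- Updating a main register of `mk`. [folklore] -/
@[simp] theorem update_mk_main (ms : V → List Bool) (cs t o r i) (x : V) (w : List Bool) :
    Function.update (mk ms cs t o r i : Regs (GReg V D)) (GReg.main x) w =
      mk (Function.update ms x w) cs t o r i := by
  funext k; cases k <;> simp [Function.update_apply, mk]

/-- Updating a counter register of `mk`. [folklore] -/
@[simp] theorem update_mk_cnt (ms : V → List Bool) (cs t o r i) (j : Fin D) (w : List Bool) :
    Function.update (mk ms cs t o r i : Regs (GReg V D)) (GReg.cnt j) w =
      mk ms (Function.update cs j w) t o r i := by
  funext k; cases k <;> simp [Function.update_apply, mk, Fin.ext_iff]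

/-- Updating the scratch register of `mk`. [folklore] -/
@[simp] theorem update_mk_tmp (ms : V → List Bool) (cs t o r i) (w : List Bool) :
    Function.update (mk ms cs t o r i : Regs (GReg V D)) GReg.tmp w = mk ms cs w o r i := by
  funext k; cases k <;> simp [mk]

/-- Updating the output register of `mk`. [folklore] -/
@[simp] theorem update_mk_out (ms : V → List Bool) (cs t o r i) (w : List Bool) :
    Function.update (mk ms cs t o r i : Regs (GReg V D)) GReg.out w = mk ms cs t w r i := by
  funext k; cases k <;> simp [mk]

/-- Updating the result register of `mk`. [folklore] -/
@[simp] theorem update_mk_res (ms : V → List Bool) (cs t o r i) (w : List Bool) :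
    Function.update (mk ms cs t o r i : Regs (GReg V D)) GReg.res w = mk ms cs t o w i := by
  funext k; cases k <;> simp [mk]

/-- Updating the input register of `mk`. [folklore] -/
@[simp] theorem update_mk_inp (ms : V → List Bool) (cs t o r i) (w : List Bool) :
    Function.update (mk ms cs t o r i : Regs (GReg V D)) GReg.inp w = mk ms cs t o r w := by
  funext k; cases k <;> simp [mk]

/-- The unary register contents of an environment. [folklore] -/
def unary (env : V → ℕ) : V → List Bool := fun x => List.replicate (env x) true

omit [DecidableEq V] in
/-- `unary` unfolds pointwise. [folklore] -/
@[simp] theorem unary_apply (env : V → ℕ) (x : V) : unary env x = List.replicate (env x) true := rfl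

/-- `unary` commutes with updates. [folklore] -/
theorem unary_update (env : V → ℕ) (x : V) (n : ℕ) :
    unary (Function.update env x n) = Function.update (unary env) x (List.replicate n true) := by
  funext y
  rcases eq_or_ne y x with rfl | h
  · simp
  · simp [Function.update_of_ne h]

/-! #### Straight-line pieces and counted loops -/

section Generic

variable {ι : Type} [DecidableEq ι]

/-- Push a word, first letter first (so the register receives it reversed). [folklore] -/
def pushes (k : ι) : List Bool → Com ι
  | [] => Com.skip
  | b :: bs => Com.push k b ;; pushes k bs

/-- `pushes` prepends the reversed word, at cost its length. [folklore] -/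
theorem runs_pushes (k : ι) : ∀ (bs : List Bool) (R : Regs ι),
    Com.Runs (pushes k bs) R (Function.update R k (bs.reverse ++ R k)) bs.length
  | [], R => by simpa [pushes] using Com.Runs.skip R
  | b :: bs, R => by
    have h := (Com.Runs.push k b R).seq (runs_pushes k bs (Function.update R k (b :: R k)))
    rw [Function.update_idem, Function.update_self] at h
    simpa [pushes, Nat.add_comm] using h

/-- The loop over a register with identical branches (reducible). [folklore] -/
abbrev loopC (k : ι) (body : Com ι) : Com ι := Com.loop k body body

/-- A function update with the old value is the identity. [folklore] -/
theorem update_eq_of_eq {β : Type} (f : ι → β) (a : ι) {v : β} (h : f a = v) :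
    Function.update f a v = f := by
  rw [← h]; exact Function.update_eq_self a f

/-- **Counted loops.** If register `k` holds `1ᴺ⁻ᵐ` in the file `F m` and the body leads from
`F m` with `k` decremented to `F (m + 1)` at cost `c m`, then the loop leads from `F 0` to
`F N` at cost `∑ c + 2 N + 1`. [Nipkow–Klein 2014, §7.2 (loop unfolding)] [folklore] -/
theorem runs_loopC {k : ι} {body : Com ι} : ∀ (N : ℕ) (F : ℕ → Regs ι) (c : ℕ → ℕ)
    (_ : ∀ m ≤ N, F m k = List.replicate (N - m) true)
    (_ : ∀ m < N, Com.Runs body (Function.update (F m) k (List.replicate (N - m - 1) true))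
      (F (m + 1)) (c m)),
    Com.Runs (loopC k body) (F 0) (F N) ((∑ m ∈ Finset.range N, c m) + 2 * N + 1)
  | 0, F, c, hF, _ => by simpa using Com.Runs.loop_nil body body (R := F 0) (by simpa using hF 0 le_rfl)
  | N + 1, F, c, hF, hb => by
    have h0 : F 0 k = true :: List.replicate N true := by
      rw [hF 0 (Nat.zero_le _)]; simp [List.replicate_succ]
    have h1 := hb 0 (Nat.succ_pos _)
    simp only [Nat.sub_zero, Nat.add_sub_cancel] at h1
    have ih := runs_loopC N (fun m => F (m + 1)) (fun m => c (m + 1))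
      (fun m hm => by rw [hF (m + 1) (by omega)]; congr 1; omega)
      (fun m hm => by
        have := hb (m + 1) (by omega)
        simpa [show N + 1 - (m + 1) - 1 = N - m - 1 by omega] using this)
    have := Com.Runs.loop_true h0 h1 ih
    refine this.mono (le_of_eq ?_)
    rw [Finset.sum_range_succ' c N]
    ring

end Generic

/-! #### Compiling expressions -/

/-- Compiled evaluation of `e`: add `1^(value)` on top of register `tgt`, using the loop
counters from `φ` on for products. [Minsky 1967, §11.1] [folklore] -/
def evalC : GExpr V → GReg V D → ℕ → Com (GReg V D)
  | GExpr.const c, tgt, _ => pushes tgt (List.replicate c true)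
  | GExpr.var x, tgt, _ =>
    loopC (GReg.main x) (Com.push GReg.tmp true ;; Com.push tgt true) ;;
      loopC GReg.tmp (Com.push (GReg.main x) true)
  | GExpr.add a b, tgt, φ => evalC a tgt φ ;; evalC b tgt φ
  | GExpr.mul a b, tgt, φ => evalC a (cntR φ) (φ + 1) ;; loopC (cntR φ) (evalC b tgt (φ + 1))

/-- **Adequacy of expression evaluation**: from a file whose variable registers hold the
environment in unary, whose scratch register and counters `≥ φ` are empty, `evalC e (cnt ψ) φ`
(`ψ < φ`) adds `1^(e.eval env)` on top of counter `ψ` and changes nothing else, at cost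
`e.cost env`. [folklore] -/
theorem evalC_runs : ∀ (e : GExpr V) {φ ψ : ℕ} (_ : ψ < φ) (_ : φ + e.depth ≤ D) (env : V → ℕ)
    (cs : ℕ → List Bool) (_ : ∀ χ, φ ≤ χ → cs χ = []) (o r i : List Bool),
    Com.Runs (evalC e (cntR ψ) φ : Com (GReg V D)) (mk (unary env) cs [] o r i)
      (mk (unary env) (Function.update cs ψ (List.replicate (e.eval env) true ++ cs ψ)) [] o r i)
      (e.cost env)
  | GExpr.const c, φ, ψ, hψ, hD, env, cs, hcs, o, r, i => by
    have hψD : ψ < D := by simp [GExpr.depth] at hD; omega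
    have := runs_pushes (cntR ψ : GReg V D) (List.replicate c true) (mk (unary env) cs [] o r i)
    rw [cntR_eq hψD] at this ⊢
    simpa [evalC, GExpr.eval, GExpr.cost] using this
  | GExpr.var x, φ, ψ, hψ, hD, env, cs, hcs, o, r, i => by
    have hψD : ψ < D := by simp [GExpr.depth] at hD; omega
    rw [cntR_eq hψD]
    simp only [evalC, GExpr.eval, GExpr.cost]
    set N := env x
    -- phase 1: move `main x` to `tmp`, copying into the counter
    let F : ℕ → Regs (GReg V D) := fun m =>
      mk (Function.update (unary env) x (List.replicate (N - m) true))
        (Function.update cs ψ (List.replicate m true ++ cs ψ)) (List.replicate m true) o r i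
    have h1 : Com.Runs (loopC (GReg.main x) (Com.push GReg.tmp true ;; Com.push (GReg.cnt ⟨ψ, hψD⟩) true))
        (F 0) (F N) ((∑ m ∈ Finset.range N, 2) + 2 * N + 1) := by
      refine runs_loopC N F (fun _ => 2) (fun m hm => by simp [F]) (fun m hm => ?_)
      have := (Com.Runs.push GReg.tmp true (Function.update (F m) (GReg.main x)
        (List.replicate (N - m - 1) true))).seq (Com.Runs.push (GReg.cnt ⟨ψ, hψD⟩) true _)
      refine this.congr ?_
      simp only [F, update_mk_main, Function.update_idem, update_mk_tmp, mk_tmp, update_mk_cnt,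
        mk_cnt, Function.update_self, Nat.sub_sub, List.replicate_succ, List.cons_append]
    -- phase 2: move `tmp` back to `main x`
    let G : ℕ → Regs (GReg V D) := fun m =>
      mk (Function.update (unary env) x (List.replicate m true))
        (Function.update cs ψ (List.replicate N true ++ cs ψ)) (List.replicate (N - m) true) o r i
    have h2 : Com.Runs (loopC GReg.tmp (Com.push (GReg.main x) true)) (G 0) (G N)
        ((∑ m ∈ Finset.range N, 1) + 2 * N + 1) := by
      refine runs_loopC N G (fun _ => 1) (fun m hm => by simp [G]) (fun m hm => ?_)
      refine (Com.Runs.push (GReg.main x) true _).congr ?_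
      simp only [G, update_mk_tmp, update_mk_main, mk_main, Function.update_self,
        Function.update_idem, Nat.sub_sub, List.replicate_succ]
    have hF0 : F 0 = mk (unary env) cs [] o r i := by
      simp only [F, Nat.sub_zero, List.replicate_zero, List.nil_append, Function.update_eq_self]
      congr 1
      exact Function.update_eq_self _ _
    have hFG : F N = G 0 := by simp [F, G]
    have hGN : G N = mk (unary env) (Function.update cs ψ (List.replicate N true ++ cs ψ)) [] o r i := by
      simp only [G, Nat.sub_self, List.replicate_zero]
      congr 1
      exact Function.update_eq_self _ _
    rw [← hF0, ← hGN]
    refine ((h1.congr hFG).seq h2).mono (le_of_eq ?_)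
    simp [Finset.sum_const, Finset.card_range]
    ring
  | GExpr.add a b, φ, ψ, hψ, hD, env, cs, hcs, o, r, i => by
    simp only [GExpr.depth] at hD
    have ha := evalC_runs a hψ (by omega) env cs hcs o r i
    have hb := evalC_runs b hψ (by omega) env
      (Function.update cs ψ (List.replicate (a.eval env) true ++ cs ψ))
      (fun χ hχ => by rw [Function.update_of_ne (by omega)]; exact hcs χ hχ) o r i
    refine (ha.seq hb).congr ?_
    simp only [GExpr.eval, Function.update_idem, Function.update_self]
    congr 2
    rw [← List.append_assoc, ← List.replicate_add, Nat.add_comm]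
  | GExpr.mul a b, φ, ψ, hψ, hD, env, cs, hcs, o, r, i => by
    simp only [GExpr.depth] at hD
    have hφD : φ < D := by omega
    simp only [evalC, GExpr.eval, GExpr.cost]
    have ha := evalC_runs a (φ := φ + 1) (ψ := φ) (Nat.lt_succ_self φ) (by omega) env cs
      (fun χ hχ => hcs χ (by omega)) o r i
    rw [hcs φ le_rfl, List.append_nil] at ha
    set va := a.eval env
    set vb := b.eval env
    let F : ℕ → Regs (GReg V D) := fun m =>
      mk (unary env) (Function.update (Function.update cs φ (List.replicate (va - m) true)) ψ
        (List.replicate (m * vb) true ++ cs ψ)) [] o r i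
    have hl : Com.Runs (loopC (cntR φ) (evalC b (cntR ψ) (φ + 1)) : Com (GReg V D)) (F 0) (F va)
        ((∑ m ∈ Finset.range va, b.cost env) + 2 * va + 1) := by
      rw [cntR_eq hφD]
      refine runs_loopC va F (fun _ => b.cost env) (fun m hm => ?_) (fun m hm => ?_)
      · simp only [F, mk_cnt]
        rw [Function.update_of_ne (Nat.ne_of_lt hψ).symm, Function.update_self]
      · have hb := evalC_runs b (φ := φ + 1) (ψ := ψ) (Nat.lt_succ_of_lt hψ) (by omega) env
          (Function.update (Function.update (Function.update cs φ (List.replicate (va - m) true)) ψ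
            (List.replicate (m * vb) true ++ cs ψ)) φ (List.replicate (va - m - 1) true))
          (fun χ hχ => by
            rw [Function.update_of_ne (by omega), Function.update_of_ne (by omega),
              Function.update_of_ne (by omega)]
            exact hcs χ (by omega)) o r i
        simp only [F, update_mk_cnt]
        refine hb.congr ?_
        congr 1
        funext χ
        simp only [Function.update_apply]
        split_ifs with h1 h2
        · omega
        · subst h1; rw [← List.append_assoc, ← List.replicate_add, Nat.succ_mul, Nat.add_comm]
        · rfl
        · rfl
    have hF0 : F 0 = mk (unary env) (Function.update cs φ (List.replicate va true ++ [])) [] o r i := by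
      simp only [F, Nat.sub_zero, Nat.zero_mul, List.replicate_zero, List.nil_append, List.append_nil]
      congr 1
      exact update_eq_of_eq _ ψ (by rw [Function.update_of_ne (Nat.ne_of_lt hψ)])
    have hFN : F va = mk (unary env) (Function.update cs ψ (List.replicate (va * vb) true ++ cs ψ)) [] o r i := by
      simp only [F, Nat.sub_self, List.replicate_zero]
      congr 1
      funext χ
      simp only [Function.update_apply]
      split_ifs with h1 h2
      · rfl
      · subst h2; exact (hcs χ le_rfl).symm
      · rfl
    rw [List.append_nil] at hF0
    rw [← hFN]
    refine ((ha.congr hF0.symm).seq hl).mono (le_of_eq ?_)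
    simp [Finset.sum_const, Finset.card_range]
    ring

/-! #### Compiling statements -/

variable (code : Γ → List Bool)

/-- Compiled generator statement, using the loop counters from `φ` on. A loop evaluates its
bound into counter `φ`, iterates "body; increment the index register", and finally clears the
index register. [Minsky 1967, §11.1; Arora–Barak 2009, §6.2 Def. 6.12] [folklore] -/
def stmtC : GStmt V Γ → ℕ → Com (GReg V D)
  | GStmt.emit ts, _ => pushes GReg.out (ts.flatMap code)
  | GStmt.seq a b, φ => stmtC a φ ;; stmtC b φ
  | GStmt.loop i e body, φ =>
    evalC e (cntR φ) (φ + 1) ;;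
      loopC (cntR φ) (stmtC body (φ + 1) ;; Com.push (GReg.main i) true) ;;
        loopC (GReg.main i) Com.skip

/-- **Adequacy of compiled statements**: from a file holding the environment in unary (loop
indices of `s` being `0`), with empty scratch and empty counters `≥ φ`, the compiled statement
pushes the coded stream (reversed) on the output register and restores everything else, at
cost `s.cost env`. [Nipkow–Klein 2014, Ch. 7–8] [folklore] -/
theorem stmtC_runs : ∀ (s : GStmt V Γ) (_ : s.noReuse = true) {φ : ℕ} (_ : φ + s.depth ≤ D)
    (env : V → ℕ) (_ : ∀ j ∈ s.loopVars, env j = 0)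
    (cs : ℕ → List Bool) (_ : ∀ χ, φ ≤ χ → cs χ = []) (o r i : List Bool),
    Com.Runs (stmtC code s φ : Com (GReg V D)) (mk (unary env) cs [] o r i)
      (mk (unary env) cs [] (((s.out env).flatMap code).reverse ++ o) r i) (s.cost code env)
  | GStmt.emit ts, _, φ, _, env, _, cs, _, o, r, i => by
    simpa [stmtC, GStmt.out, GStmt.cost] using
      runs_pushes (GReg.out : GReg V D) (ts.flatMap code) (mk (unary env) cs [] o r i)
  | GStmt.seq a b, hs, φ, hD, env, h0, cs, hcs, o, r, i => by
    simp only [GStmt.noReuse, Bool.and_eq_true] at hs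
    simp only [GStmt.depth] at hD
    simp only [GStmt.loopVars, List.mem_append] at h0
    have ha := stmtC_runs a hs.1 (φ := φ) (by omega) env (fun j hj => h0 j (Or.inl hj)) cs hcs o r i
    have hb := stmtC_runs b hs.2 (φ := φ) (by omega) env (fun j hj => h0 j (Or.inr hj)) cs hcs
      (((a.out env).flatMap code).reverse ++ o) r i
    simpa [stmtC, GStmt.out, GStmt.cost, List.reverse_append] using ha.seq hb
  | GStmt.loop x e body, hs, φ, hD, env, h0, cs, hcs, o, r, i => by
    simp only [GStmt.noReuse, Bool.and_eq_true, decide_eq_true_eq] at hs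
    simp only [GStmt.depth] at hD
    simp only [GStmt.loopVars, List.mem_cons, forall_eq_or_imp] at h0
    have hφD : φ < D := by omega
    simp only [stmtC, GStmt.out, GStmt.cost]
    -- evaluate the bound
    have he := evalC_runs (D := D) e (φ := φ + 1) (ψ := φ) (Nat.lt_succ_self φ) (by omega) env cs
      (fun χ hχ => hcs χ (by omega)) o r i
    rw [hcs φ le_rfl, List.append_nil] at he
    set N := e.eval env
    -- the main loop
    let acc : ℕ → List Bool := fun m =>
      (((List.range m).flatMap fun k => body.out (Function.update env x k)).flatMap code).reverse
    let F : ℕ → Regs (GReg V D) := fun m =>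
      mk (unary (Function.update env x m)) (Function.update cs φ (List.replicate (N - m) true)) []
        (acc m ++ o) r i
    have hl : Com.Runs (loopC (cntR φ) (stmtC code body (φ + 1) ;; Com.push (GReg.main x) true) :
        Com (GReg V D)) (F 0) (F N)
        ((∑ m ∈ Finset.range N, (body.cost code (Function.update env x m) + 1)) + 2 * N + 1) := by
      rw [cntR_eq hφD]
      refine runs_loopC N F _ (fun m hm => by simp [F]) (fun m hm => ?_)
      have hb := stmtC_runs body hs.2 (φ := φ + 1) (by omega) (Function.update env x m)
        (fun j hj => by
          rw [Function.update_of_ne (fun h : j = x => hs.1 (h ▸ hj))]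
          exact h0.2 j hj)
        (Function.update (Function.update cs φ (List.replicate (N - m) true)) φ
          (List.replicate (N - m - 1) true))
        (fun χ hχ => by
          rw [Function.update_of_ne (by omega), Function.update_of_ne (by omega)]
          exact hcs χ (by omega))
        (acc m ++ o) r i
      have hp := Com.Runs.push (GReg.main x) true
        (mk (unary (Function.update env x m))
          (Function.update (Function.update cs φ (List.replicate (N - m) true)) φ
            (List.replicate (N - m - 1) true)) []
          ((((body.out (Function.update env x m)).flatMap code).reverse ++ (acc m ++ o))) r i :
          Regs (GReg V D))
      simp only [F, update_mk_cnt]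
      refine (hb.seq hp).congr ?_
      rw [update_mk_main, Function.update_idem]
      congr 1
      · rw [unary_update, unary_update, Function.update_idem, mk_main, Function.update_self]
        simp [List.replicate_succ]
      · simp only [acc]
        rw [List.range_succ, List.flatMap_append, List.flatMap_append, List.reverse_append,
          List.flatMap_singleton, List.append_assoc]
    -- clearing the index register
    let G : ℕ → Regs (GReg V D) := fun m =>
      mk (Function.update (unary env) x (List.replicate (N - m) true)) cs [] (acc N ++ o) r i
    have hc : Com.Runs (loopC (GReg.main x) Com.skip : Com (GReg V D)) (G 0) (G N)
        ((∑ m ∈ Finset.range N, 0) + 2 * N + 1) := by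
      refine runs_loopC N G (fun _ => 0) (fun m hm => by simp [G]) (fun m hm => ?_)
      refine (Com.Runs.skip _).congr ?_
      simp only [G, update_mk_main, Function.update_idem, Nat.sub_sub]
    have hF0 : F 0 = mk (unary env) (Function.update cs φ (List.replicate N true)) [] o r i := by
      simp only [F, acc, Nat.sub_zero, List.range_zero, List.flatMap_nil, List.reverse_nil,
        List.nil_append]
      congr 1
      rw [← h0.1]; exact congrArg unary (Function.update_eq_self x env)
    have hFG : F N = G 0 := by
      simp only [F, G, Nat.sub_self, List.replicate_zero, Nat.sub_zero, unary_update]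
      congr 1
      rw [← hcs φ le_rfl]; exact Function.update_eq_self φ cs
    have hGN : G N = mk (unary env) cs [] (acc N ++ o) r i := by
      simp only [G, Nat.sub_self, List.replicate_zero]
      congr 1
      rw [← Function.update_eq_self x (unary env)]
      simp [h0.1]
    have hfin := (he.congr hF0.symm).seq ((hl.congr hFG).seq hc)
    rw [← hGN]
    refine hfin.mono (le_of_eq ?_)
    simp only [Finset.sum_const_zero, Nat.zero_add]
    omega

/-! #### The whole program -/

/-- The environment of an input of length `n`: the input variable holds `n`, all others `0`.
[folklore] -/
def initEnv (x₀ : V) (n : ℕ) : V → ℕ := Function.update (fun _ => 0) x₀ n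

/-- The input variable of `initEnv` holds the input length. [folklore] -/
@[simp] theorem initEnv_self (x₀ : V) (n : ℕ) : initEnv x₀ n x₀ = n := by simp [initEnv]

/-- All other variables of `initEnv` hold `0`. [folklore] -/
theorem initEnv_of_ne {x₀ x : V} (h : x ≠ x₀) (n : ℕ) : initEnv x₀ n x = 0 := by
  simp [initEnv, Function.update_of_ne h]

/-- Every variable of `initEnv` is at most the input length. [folklore] -/
theorem initEnv_le (x₀ : V) (n : ℕ) (x : V) : initEnv x₀ n x ≤ n := by
  rcases eq_or_ne x x₀ with rfl | h
  · simp
  · simp [initEnv_of_ne h]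

/-- **The compiled generator**: count the input length into the input variable, run the
statement, pour the reversed output into the result register. [folklore] -/
def progC (x₀ : V) (s : GStmt V Γ) : Com (GReg V D) :=
  loopC GReg.inp (Com.push (GReg.main x₀) true) ;; stmtC code s 0 ;;
    Com.loop GReg.out (Com.push GReg.res true) (Com.push GReg.res false)

/-- Counting the input. [folklore] -/
theorem runs_count (x₀ : V) (cs : ℕ → List Bool) (t o r : List Bool) :
    ∀ (w : List Bool) (m : ℕ),
    Com.Runs (loopC GReg.inp (Com.push (GReg.main x₀) true) : Com (GReg V D))
      (mk (unary (initEnv x₀ m)) cs t o r w) (mk (unary (initEnv x₀ (m + w.length))) cs t o r [])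
      (3 * w.length + 1)
  | [], m => by
    simpa using Com.Runs.loop_nil (R := (mk (unary (initEnv x₀ m)) cs t o r [] : Regs (GReg V D)))
      (Com.push (GReg.main x₀) true) (Com.push (GReg.main x₀) true) rfl
  | b :: w, m => by
    have h1 := Com.Runs.push (GReg.main x₀) true (mk (unary (initEnv x₀ m)) cs t o r w : Regs (GReg V D))
    have e1 : Function.update (mk (unary (initEnv x₀ m)) cs t o r w : Regs (GReg V D)) (GReg.main x₀)
        (true :: (mk (unary (initEnv x₀ m)) cs t o r w : Regs (GReg V D)) (GReg.main x₀)) =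
        mk (unary (initEnv x₀ (m + 1))) cs t o r w := by
      rw [update_mk_main, mk_main]
      congr 1
      simp only [initEnv, Function.update_idem, unary_update, unary_apply, Function.update_self]
      simp [List.replicate_succ]
    rw [e1] at h1
    have ih := runs_count x₀ cs t o r w (m + 1)
    rw [show m + 1 + w.length = m + (b :: w).length by simp; omega] at ih
    have hk : (mk (unary (initEnv x₀ m)) cs t o r (b :: w) : Regs (GReg V D)) GReg.inp = b :: w := rfl
    cases b
    · exact (Com.Runs.loop_false hk (by rw [update_mk_inp]; exact h1) ih).mono (by simp; omega)
    · exact (Com.Runs.loop_true hk (by rw [update_mk_inp]; exact h1) ih).mono (by simp; omega)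

/-- Pouring the output into the result register restores the order. [folklore] -/
theorem runs_pour (ms : V → List Bool) (cs : ℕ → List Bool) (t i : List Bool) :
    ∀ (w r : List Bool),
    Com.Runs (Com.loop GReg.out (Com.push GReg.res true) (Com.push GReg.res false) : Com (GReg V D))
      (mk ms cs t w r i) (mk ms cs t [] (w.reverse ++ r) i) (3 * w.length + 1)
  | [], r => by
    simpa using Com.Runs.loop_nil (R := (mk ms cs t [] r i : Regs (GReg V D)))
      (Com.push GReg.res true) (Com.push GReg.res false) rfl
  | b :: w, r => by
    have ih := runs_pour ms cs t i w (b :: r)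
    rw [show w.reverse ++ b :: r = (b :: w).reverse ++ r by simp] at ih
    have hk : (mk ms cs t (b :: w) r i : Regs (GReg V D)) GReg.out = b :: w := rfl
    cases b
    · have h1 := Com.Runs.push GReg.res false (mk ms cs t w r i : Regs (GReg V D))
      rw [update_mk_res, mk_res] at h1
      exact (Com.Runs.loop_false hk (by rw [update_mk_out]; exact h1) ih).mono (by simp; omega)
    · have h1 := Com.Runs.push GReg.res true (mk ms cs t w r i : Regs (GReg V D))
      rw [update_mk_res, mk_res] at h1
      exact (Com.Runs.loop_true hk (by rw [update_mk_out]; exact h1) ih).mono (by simp; omega)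

/-- The initial register file of the machine is `mk` of the empty environment. [folklore] -/
theorem init_eq (z : List Bool) (x₀ : V) :
    (Regs.init GReg.inp z : Regs (GReg V D)) = mk (unary (initEnv x₀ 0)) (fun _ => []) [] [] [] z := by
  funext k
  cases k <;> simp [Regs.init, mk, initEnv]

/-- **The whole run**: on input `z`, the compiled generator leaves the coded stream of
`out s (x₀ ↦ |z|)` in the result register within `6 · cost + 3 |z| + 2` steps. [folklore] -/
theorem progC_runs (x₀ : V) (s : GStmt V Γ) (hx : x₀ ∉ s.loopVars) (hs : s.noReuse = true)
    (hD : s.depth ≤ D) (z : List Bool) :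
    Com.Runs (progC code x₀ s : Com (GReg V D)) (Regs.init GReg.inp z)
      (mk (unary (initEnv x₀ z.length)) (fun _ => []) [] []
        ((s.out (initEnv x₀ z.length)).flatMap code) [])
      (3 * z.length + 1 + s.cost code (initEnv x₀ z.length) +
        (3 * s.cost code (initEnv x₀ z.length) + 1)) := by
  rw [init_eq z x₀]
  have h1 := runs_count (D := D) x₀ (fun _ => []) [] [] [] z 0
  rw [Nat.zero_add] at h1
  have h2 := stmtC_runs (D := D) code s hs (φ := 0) (by omega) (initEnv x₀ z.length)
    (fun j hj => initEnv_of_ne (fun h : j = x₀ => hx (h ▸ hj)) _) (fun _ => []) (fun _ _ => rfl) [] [] []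
  have h3 := runs_pour (D := D) (unary (initEnv x₀ z.length)) (fun _ => []) [] []
    (((s.out (initEnv x₀ z.length)).flatMap code).reverse ++ []) []
  simp only [List.append_nil, List.reverse_reverse, List.length_reverse] at h2 h3
  exact (h1.seq (h2.seq h3)).mono (by have := s.length_out_le code (initEnv x₀ z.length); omega)

end GenProg

/-! ### Polynomial time -/

namespace GStmt

variable {V Γ : Type} [DecidableEq V] [Fintype V]

/-- **Generator programs produce `FP` streams**: the coded stream of `out s (x₀ ↦ |z|)` is a
polynomial-time function of `z`. [Arora–Barak 2009, §6.2 Def. 6.12; Nipkow–Klein 2014,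
Ch. 8] [folklore] -/
theorem out_mem_FP (code : Γ → List Bool) (s : GStmt V Γ) (x₀ : V) (hx : x₀ ∉ s.loopVars)
    (hs : s.noReuse = true) :
    (fun z => (s.out (GenProg.initEnv x₀ z.length)).flatMap code) ∈ FP := by
  refine Com.mem_FP (ι := GReg V s.depth) (GenProg.progC code x₀ s) GReg.inp GReg.res
    (3 * X + 4 * s.cpoly code + 2) _ fun z =>
      ⟨GenProg.mk (GenProg.unary (GenProg.initEnv x₀ z.length)) (fun _ => []) [] []
        ((s.out (GenProg.initEnv x₀ z.length)).flatMap code) [], Or.inl ?_, rfl⟩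
  refine (GenProg.progC_runs code x₀ s hx hs le_rfl z).mono ?_
  have := s.cost_le code (GenProg.initEnv_le x₀ z.length)
  simp only [eval_add, eval_mul, eval_ofNat, eval_X]
  omega

end GStmt

/-! ### Decoding a three-bit block code by a finite-state transducer -/

namespace GenProg

variable {Γ : Type}

/-- The three-bit block code of a letter. [folklore] -/
def code3 (enc : Γ → Bool × Bool × Bool) (t : Γ) : List Bool :=
  [(enc t).1, (enc t).2.1, (enc t).2.2]

/-- The decoding transducer of a three-bit block code: buffer two bits, emit on the third.
[Hopcroft–Ullman 1979, §2.7] [folklore] -/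
def decFST (dec : Bool → Bool → Bool → List Γ) : FST (Option Bool × Option Bool) Bool Γ where
  init := (none, none)
  step s b := match s with
    | (none, _) => ((some b, none), [])
    | (some b₁, none) => ((some b₁, some b), [])
    | (some b₁, some b₂) => ((none, none), dec b₁ b₂ b)
  front _ := []
  keep _ := true

/-- The decoder inverts the block code. [folklore] -/
theorem decFST_eval {enc : Γ → Bool × Bool × Bool} {dec : Bool → Bool → Bool → List Γ}
    (hdec : ∀ t, dec (enc t).1 (enc t).2.1 (enc t).2.2 = [t]) (ts : List Γ) :
    (decFST dec).eval (ts.flatMap (code3 enc)) = ts := by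
  have : ∀ ts : List Γ, (decFST dec).run (none, none) (ts.flatMap (code3 enc)) = ((none, none), ts) := by
    intro ts
    induction ts with
    | nil => rfl
    | cons t ts ih =>
      rw [List.flatMap_cons, code3]
      simp [decFST, FST.run_cons, hdec] at ih ⊢
      simp [ih]
  unfold FST.eval
  rw [show (decFST dec).init = (none, none) from rfl, this]
  simp [decFST]

/-- **From an `FP` coded stream on unary inputs to a polynomial-time stream.** If `f ∈ FP`
and `f (1ⁿ)` is the block coding of `toks n`, then `toks` is `PolyTimeComputable` from `1ⁿ`
(decode by the transducer; `PolyTimeComputable.comp_holds`). [Arora–Barak 2009, §1.3]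
[folklore] -/
theorem polyTimeComputable_of_FP [Fintype Γ] {enc : Γ → Bool × Bool × Bool}
    {dec : Bool → Bool → Bool → List Γ} (hdec : ∀ t, dec (enc t).1 (enc t).2.1 (enc t).2.2 = [t])
    (toks : ℕ → List Γ) {f : List Bool → List Bool} (hf : f ∈ FP)
    (hfe : ∀ n, f (unaryEncodeNat n) = (toks n).flatMap (code3 enc)) :
    PolyTimeComputable unaryEncodeNat (id : List Γ → List Γ) toks := by
  have h1 : PolyTimeComputable unaryEncodeNat (id : List Bool → List Bool)
      (fun n => f (unaryEncodeNat n)) := by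
    obtain ⟨p, M, hM⟩ := hf
    exact ⟨p, M, fun n => hM (unaryEncodeNat n)⟩
  have h2 := PolyTimeComputable.comp_holds (FST.polyTimeComputable_eval (decFST dec)) h1
  have hfun : (FST.eval (decFST dec) ∘ fun n => f (unaryEncodeNat n)) = toks := by
    funext n
    simp [hfe, decFST_eval hdec]
  rwa [hfun] at h2

end GenProg

namespace GStmt

variable {V Γ : Type} [DecidableEq V] [Fintype V] [Fintype Γ]

/-- `|1ⁿ| = n`. [folklore] -/
private theorem length_unaryEncodeNat' : ∀ n : ℕ, (unaryEncodeNat n).length = n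
  | 0 => rfl
  | n + 1 => by simp [unaryEncodeNat, length_unaryEncodeNat' n]

/-- **Generator programs are polynomial-time stream generators.** For a program `s` whose
loop indices avoid the input variable `x₀` and are not reused in nested loops, and an output
alphabet with a three-bit block code, the stream `n ↦ out s (x₀ ↦ n)` is `PolyTimeComputable`
from the unary input `1ⁿ`. [Arora–Barak 2009, §6.2 Def. 6.12, Remark 6.7]
[folklore] -/
theorem polyTimeComputable_out (s : GStmt V Γ) (x₀ : V) (hx : x₀ ∉ s.loopVars)
    (hs : s.noReuse = true) {enc : Γ → Bool × Bool × Bool} {dec : Bool → Bool → Bool → List Γ}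
    (hdec : ∀ t, dec (enc t).1 (enc t).2.1 (enc t).2.2 = [t]) :
    PolyTimeComputable unaryEncodeNat (id : List Γ → List Γ)
      fun n => s.out (GenProg.initEnv x₀ n) :=
  GenProg.polyTimeComputable_of_FP hdec _ (s.out_mem_FP (GenProg.code3 enc) x₀ hx hs)
    fun n => by simp [length_unaryEncodeNat']

end GStmt

end Literature.Computability.Complexity
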